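import Summits.Ventures.PercRepro.Night2FatZOneA
import Summits.Ventures.PercRepro.Night2FatZSpine

/-!
# night-2: exactly one basis point on the spine (B) — distance-1 through a point off the spine, pair families, the spine–plane pairs

With at most one basis point on the spine every loaded target through a point of `W ∖ {x}` off the spine is a distance-1
load (`d1_through_off_spine_of_one_basis_point`); a family of pairs with unloaded targets bounds the level-3 sum
(`card_pairs_le_unloaded_level_three_sum`); a spine point and a point of the plane with a single basis point off the spine
form an unloaded pair (`dload_eq_zero_of_spine_plane_pair`).  Paper `proofs/NIGHT-2-g34.md` §6 (b).
-/

namespace PercRepro.Shadow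

open PercRepro.ThmH PercRepro.PerFlat

variable {α : Type*} [DecidableEq α] {M : Matroid α} [M.Finite] {G : Finset α}

/-- **With at most one basis point `a` on the spine, every loaded target through a point `y` of `W ∖ {x}` off the spine
is a distance-1 load**: a distance-2 line lies in the spine, misses `y` only, and would have `|Y| + 1` points inside
`{a} ∪ (Y ∖ {y})`. -/
theorem d1_through_off_spine_of_one_basis_point (hG : G ∈ flatsQ M (5 + 1)) (hd : (gr M \ G).card = 2)
    (hk : kColoops M G = 1) (hs : ∀ e ∈ gr M, ∀ f ∈ gr M, e ≠ f → rkN M {e, f} = 2)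
    (hl : ∀ e ∈ gr M, M.Indep {e}) (hfat : (fatClosures M 5 G 2).card ≤ 1) {B₀ : Finset α}
    (hB₀ : B₀ ∈ thinMembers M 5 G) {w₀ x : α} (hD : G \ clF M B₀ = {w₀, x}) {R₁ : Finset α}
    (hR₁V : R₁ ⊆ (G \ coloops M G) \ {w₀, x}) (hR₁2 : rkN M R₁ = 2) (hR₁3 : 3 ≤ R₁.card) {c₂ c₃ : α}
    (hc₂V : c₂ ∈ (G \ coloops M G) \ {w₀, x}) (hc₃V : c₃ ∈ (G \ coloops M G) \ {w₀, x})
    (hc₂ : c₂ ∉ clF M R₁) (hc₃ : c₃ ∉ clF M (insert c₂ R₁))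
    (hcover : ∀ e ∈ (G \ coloops M G) \ {w₀, x}, e ∈ clF M (insert c₂ R₁) ∨ e ∈ clF M (insert c₃ R₁))
    (hnd₂ : 3 ≤ rkN M (((G \ coloops M G) \ {w₀, x}).filter
      (fun e => e ∈ clF M (insert c₂ R₁) ∧ e ∉ clF M R₁)))
    (hnd₃ : 3 ≤ rkN M (((G \ coloops M G) \ {w₀, x}).filter
      (fun e => e ∈ clF M (insert c₃ R₁) ∧ e ∉ clF M R₁)))
    {B : Finset α} (hB : B ∈ thinMembers M 5 G) (hnP : ¬ bigP M G B) {z : α} (hz : z ∈ G \ clF M B)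
    (hxQ : x ∉ insert z B) {a : α} (hP₀ : ∀ e ∈ insert z B \ coloops M G, e ∈ clF M R₁ → e = a)
    {y : α} (hy : y ∈ (G \ insert z B).erase x) (hyL : y ∉ clF M R₁) :
    ∀ T ∈ tgtSets M 5 G B z, x ∈ T → y ∈ T → dload M 5 G (bigP M G) (dshGT2 M 5 G) T ≠ 0 →
      ∃ R ⊆ (T \ coloops M G) \ {w₀, x}, rkN M R = 2 ∧ 3 ≤ R.card ∧ R.card + 4 = (T \ coloops M G).card ∧
        3 ≤ rkN M (G \ T) := by
  intro T hT hxT hyT hload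
  have hTG : T ⊆ G := subset_G_of_mem_shadowAt (mem_tgtSets.1 hT).1
  obtain ⟨R, hR, hR2, hR3, hcase⟩ := loaded_fat_target_dichotomy' hG hd hk hs hl hfat hB₀ hD hTG hload
  rcases hcase with ⟨hRc, hrk⟩ | ⟨hRc, -, c₂', hc₂'T, c₃', hc₃'T, hc₂', hc₃', hcover'⟩
  · exact ⟨R, hR, hR2, hR3, hRc, hrk⟩
  · exfalso
    have hRL := line_subset_spine_of_dist_two_of_nondeg hG hs hR₁V hR₁2 hR₁3 hc₂V hc₃V hc₂ hc₃ hcover hnd₂ hnd₃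
      hTG hR hR2 hR3 hc₂'T hc₃'T hc₂' hc₃' hcover'
    have hyR : y ∉ R := fun h' => hyL (hRL h')
    have hyx : y ≠ x := (Finset.mem_erase.1 hy).1
    have hyQ : y ∉ insert z B := (Finset.mem_sdiff.1 (Finset.mem_of_mem_erase hy)).2
    have hyY : y ∈ (T \ insert z B).erase x := Finset.mem_erase.2 ⟨hyx, Finset.mem_sdiff.2 ⟨hyT, hyQ⟩⟩
    -- `R ⊆ (Y ∖ {y}) ∪ {a}`
    have hsub : R ⊆ insert a (((T \ insert z B).erase x).erase y) := by
      intro r hr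
      have hr' := Finset.mem_sdiff.1 (hR hr)
      rw [Finset.mem_insert, Finset.mem_singleton, not_or] at hr'
      rw [Finset.mem_insert]
      by_cases hrQ : r ∈ insert z B
      · exact Or.inl (hP₀ r (Finset.mem_sdiff.2 ⟨hrQ, (Finset.mem_sdiff.1 hr'.1).2⟩) (hRL hr))
      · right
        refine Finset.mem_erase.2 ⟨fun h' => hyR (h' ▸ hr), Finset.mem_erase.2 ⟨hr'.2.2, ?_⟩⟩
        exact Finset.mem_sdiff.2 ⟨(Finset.mem_sdiff.1 hr'.1).1, hrQ⟩
    have hlev := card_sdiff_coloops_eq_level_add_five hG hd hk hB hnP hz hT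
    have hxTQ : x ∈ T \ insert z B := Finset.mem_sdiff.2 ⟨hxT, hxQ⟩
    have hY : ((T \ insert z B).erase x).card + 1 = (T \ insert z B).card := by
      rw [Finset.card_erase_of_mem hxTQ]
      have : 0 < (T \ insert z B).card := Finset.card_pos.2 ⟨x, hxTQ⟩
      omega
    have hYy : (((T \ insert z B).erase x).erase y).card + 1 = ((T \ insert z B).erase x).card := by
      rw [Finset.card_erase_of_mem hyY]
      have : 0 < ((T \ insert z B).erase x).card := Finset.card_pos.2 ⟨y, hyY⟩
      omega
    have h1 := Finset.card_le_card hsub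
    have h2 := Finset.card_insert_le a (((T \ insert z B).erase x).erase y)
    omega

/-- **A family of pairs with unloaded targets bounds the level-3 sum**: `U`, `V` disjoint subsets of `W ∖ {x}`, a set
`S` of pairs `(u, v) ∈ U × V` whose targets `Q ∪ {x, u, v}` are unloaded: `|S| · fatTerm 3 c₃ ≤` the level-3 sum. -/
theorem card_pairs_le_unloaded_level_three_sum (hG : G ∈ flatsQ M (5 + 1)) (hd : (gr M \ G).card = 2)
    (hk : kColoops M G = 1) {B : Finset α} (hB : B ∈ thinMembers M 5 G) (hnP : ¬ bigP M G B) {z : α}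
    (hz : z ∈ G \ clF M B) {x : α} (hx : x ∈ G \ insert z B) {U V : Finset α}
    (hU : U ⊆ (G \ insert z B).erase x) (hV : V ⊆ (G \ insert z B).erase x) (hUV : Disjoint U V)
    {S : Finset (α × α)} (hS : S ⊆ U ×ˢ V)
    (hload : ∀ p ∈ S, dload M 5 G (bigP M G) (dshGT2 M 5 G) (insert z B ∪ {x, p.1, p.2}) = 0) :
    (S.card : ℚ) * fatTerm 3 (if (G \ insert z B).card - 3 ≤ 3 then 1 else 11 / 18) ≤
      ∑ T ∈ ((tgtSets M 5 G B z).filter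
        (fun T => x ∈ T ∧ dload M 5 G (bigP M G) (dshGT2 M 5 G) T = 0)).filter
        (fun T => (T \ insert z B).card = 3),
        capS M 5 G T / ((221 / 360 : ℚ) * ((2 * ((T \ coloops M G).card - 2).choose 4 : ℕ) : ℚ)) := by
  have hd' : (gr M \ G).card ≤ 5 := by omega
  have hBm : B ∈ membersIn M (Uq M (5 + 2) 5) G := (mem_thinMembers.1 hB).1
  have hxQ : x ∉ insert z B := (Finset.mem_sdiff.1 hx).2
  set F := ((tgtSets M 5 G B z).filter
    (fun T => x ∈ T ∧ dload M 5 G (bigP M G) (dshGT2 M 5 G) T = 0)).filter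
    (fun T => (T \ insert z B).card = 3) with hF
  have hterm : ∀ T ∈ F, fatTerm 3 (if (G \ insert z B).card - 3 ≤ 3 then 1 else 11 / 18) ≤
      capS M 5 G T / ((221 / 360 : ℚ) * ((2 * ((T \ coloops M G).card - 2).choose 4 : ℕ) : ℚ)) := by
    intro T hT
    rw [hF, Finset.mem_filter, Finset.mem_filter] at hT
    obtain ⟨⟨hTt, -, -⟩, hTj⟩ := hT
    have hTG : T ⊆ G := subset_G_of_mem_shadowAt (mem_tgtSets.1 hTt).1
    have hTK : (T \ coloops M G).card = 3 + 5 := by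
      rw [card_sdiff_coloops_eq_level_add_five hG hd hk hB hnP hz hTt, hTj]
    have hGT := card_sdiff_add_card_sdiff_of_mem_tgtSets hTt
    unfold fatTerm
    rw [hTK]
    apply div_le_div_of_nonneg_right _ (by positivity)
    split_ifs with h3
    · rw [capS_eq_one_of_card_sdiff_le_three hd (by omega)]
    · exact capS_ge_eleven_eighteenths_two_one hd hk hTG
  have hmaps : ∀ p ∈ S, insert z B ∪ {x, p.1, p.2} ∈ F := by
    intro p hp
    have hpUV := Finset.mem_product.1 (hS hp)
    have hu : p.1 ∈ (G \ insert z B).erase x := hU hpUV.1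
    have hv : p.2 ∈ (G \ insert z B).erase x := hV hpUV.2
    have hux : p.1 ≠ x := (Finset.mem_erase.1 hu).1
    have hvx : p.2 ≠ x := (Finset.mem_erase.1 hv).1
    have huv : p.1 ≠ p.2 := fun h' => Finset.disjoint_left.1 hUV hpUV.1 (h' ▸ hpUV.2)
    have hXsub : ({x, p.1, p.2} : Finset α) ⊆ G \ insert z B := by
      intro e he
      rw [Finset.mem_insert, Finset.mem_insert, Finset.mem_singleton] at he
      rcases he with rfl | rfl | rfl
      · exact hx
      · exact Finset.mem_of_mem_erase hu
      · exact Finset.mem_of_mem_erase hv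
    have hTt : insert z B ∪ {x, p.1, p.2} ∈ tgtSets M 5 G B z := by
      rw [tgtSets_eq_image hG hBm hz, Finset.mem_image]
      exact ⟨{x, p.1, p.2}, Finset.mem_filter.2 ⟨Finset.mem_powerset.2 hXsub, ⟨x, Finset.mem_insert_self _ _⟩⟩, rfl⟩
    have hsd : (insert z B ∪ {x, p.1, p.2}) \ insert z B = {x, p.1, p.2} := by
      rw [Finset.union_sdiff_left]
      apply Finset.sdiff_eq_self_of_disjoint
      rw [Finset.disjoint_left]
      intro e he
      exact (Finset.mem_sdiff.1 (hXsub he)).2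
    have hc3 : ((insert z B ∪ {x, p.1, p.2}) \ insert z B).card = 3 := by
      rw [hsd, Finset.card_insert_of_notMem, Finset.card_pair huv]
      rw [Finset.mem_insert, Finset.mem_singleton, not_or]
      exact ⟨hux.symm, hvx.symm⟩
    rw [hF, Finset.mem_filter, Finset.mem_filter]
    exact ⟨⟨hTt, Finset.mem_union_right _ (Finset.mem_insert_self _ _), hload p hp⟩, hc3⟩
  have hinj : Set.InjOn (fun p : α × α => insert z B ∪ {x, p.1, p.2}) (S : Set (α × α)) := by
    intro p hp q hq heq
    rw [Finset.mem_coe] at hp hq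
    have hpUV := Finset.mem_product.1 (hS hp)
    have hqUV := Finset.mem_product.1 (hS hq)
    simp only at heq
    have key : ∀ e : α, e ∈ (G \ insert z B).erase x → e ∈ insert z B ∪ {x, p.1, p.2} → e = p.1 ∨ e = p.2 := by
      intro e he hmem
      have hex : e ≠ x := (Finset.mem_erase.1 he).1
      have heQ : e ∉ insert z B := (Finset.mem_sdiff.1 (Finset.mem_of_mem_erase he)).2
      simp only [Finset.mem_union, Finset.mem_insert, Finset.mem_singleton] at hmem
      rcases hmem with h | h | h | h
      · exact absurd (Finset.mem_insert.2 h) heQ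
      · exact absurd h hex
      · exact Or.inl h
      · exact Or.inr h
    have hq1 : q.1 = p.1 ∨ q.1 = p.2 := key q.1 (hU hqUV.1)
      (heq ▸ Finset.mem_union_right _ (Finset.mem_insert_of_mem (Finset.mem_insert_self _ _)))
    have hq2 : q.2 = p.1 ∨ q.2 = p.2 := key q.2 (hV hqUV.2)
      (heq ▸ Finset.mem_union_right _ (Finset.mem_insert_of_mem (Finset.mem_insert_of_mem (Finset.mem_singleton_self _))))
    have hq1' : q.1 = p.1 := by
      rcases hq1 with h | h
      · exact h
      · exact absurd (h ▸ hqUV.1) (Finset.disjoint_right.1 hUV hpUV.2)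
    have hq2' : q.2 = p.2 := by
      rcases hq2 with h | h
      · exact absurd (h ▸ hqUV.2) (Finset.disjoint_left.1 hUV hpUV.1)
      · exact h
    exact Prod.ext hq1'.symm hq2'.symm
  have hcount : S.card ≤ F.card := Finset.card_le_card_of_injOn _ (fun p hp => hmaps p hp) hinj
  have hpos : 0 ≤ fatTerm 3 (if (G \ insert z B).card - 3 ≤ 3 then 1 else 11 / 18) := by
    unfold fatTerm
    split_ifs <;> positivity
  calc (S.card : ℚ) * fatTerm 3 (if (G \ insert z B).card - 3 ≤ 3 then 1 else 11 / 18)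
      ≤ (F.card : ℚ) * fatTerm 3 (if (G \ insert z B).card - 3 ≤ 3 then 1 else 11 / 18) := by
        apply mul_le_mul_of_nonneg_right _ hpos
        exact_mod_cast hcount
    _ = ∑ _T ∈ F, fatTerm 3 (if (G \ insert z B).card - 3 ≤ 3 then 1 else 11 / 18) := by
        rw [Finset.sum_const, nsmul_eq_mul]
    _ ≤ _ := Finset.sum_le_sum (fun T hT => hterm T hT)

/-- **A spine point and a point of the plane with a single basis point off the spine form an unloaded pair**: with
`a` the only basis point on the spine and `d` the only basis point of `π₃` off it, the target `Q ∪ {x, s, q}`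
(`s ∈ W ∖ {x}` on the spine, `q ∈ W ∖ {x}` in `π₃` off the spine) is unloaded — a distance-1 line through `s, q` lies
in `π₃` and its two basis points are `a, d`, putting `d` on the spine; a distance-2 line lies in the spine and has at
most the two points `a, s`. -/
theorem dload_eq_zero_of_spine_plane_pair (hG : G ∈ flatsQ M (5 + 1)) (hd : (gr M \ G).card = 2)
    (hk : kColoops M G = 1) (hs : ∀ e ∈ gr M, ∀ f ∈ gr M, e ≠ f → rkN M {e, f} = 2)
    (hl : ∀ e ∈ gr M, M.Indep {e}) (hfat : (fatClosures M 5 G 2).card ≤ 1) {B₀ : Finset α}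
    (hB₀ : B₀ ∈ thinMembers M 5 G) {w₀ x : α} (hD : G \ clF M B₀ = {w₀, x}) {R₁ : Finset α}
    (hR₁V : R₁ ⊆ (G \ coloops M G) \ {w₀, x}) (hR₁2 : rkN M R₁ = 2) (hR₁3 : 3 ≤ R₁.card) {c₂ c₃ : α}
    (hc₂V : c₂ ∈ (G \ coloops M G) \ {w₀, x}) (hc₃V : c₃ ∈ (G \ coloops M G) \ {w₀, x})
    (hc₂ : c₂ ∉ clF M R₁) (hc₃ : c₃ ∉ clF M (insert c₂ R₁))
    (hcover : ∀ e ∈ (G \ coloops M G) \ {w₀, x}, e ∈ clF M (insert c₂ R₁) ∨ e ∈ clF M (insert c₃ R₁))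
    (hnd₂ : 3 ≤ rkN M (((G \ coloops M G) \ {w₀, x}).filter
      (fun e => e ∈ clF M (insert c₂ R₁) ∧ e ∉ clF M R₁)))
    (hnd₃ : 3 ≤ rkN M (((G \ coloops M G) \ {w₀, x}).filter
      (fun e => e ∈ clF M (insert c₃ R₁) ∧ e ∉ clF M R₁)))
    {B : Finset α} (hB : B ∈ thinMembers M 5 G) (hnP : ¬ bigP M G B) {z : α} (hz : z ∈ G \ clF M B)
    (hw₀ : w₀ ∈ insert z B) (hx : x ∈ G \ insert z B) {a d : α}
    (haP : a ∈ (insert z B \ coloops M G).erase w₀) (haL : a ∈ clF M R₁)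
    (hP₀a : ∀ e ∈ insert z B \ coloops M G, e ∈ clF M R₁ → e = a)
    (hdP : d ∈ (insert z B \ coloops M G).erase w₀) (hdL : d ∉ clF M R₁)
    (hP₀d : ∀ e ∈ insert z B \ coloops M G, e ∈ clF M (insert c₃ R₁) → e ∉ clF M R₁ → e = d)
    {s q : α} (hsW : s ∈ (G \ insert z B).erase x) (hsL : s ∈ clF M R₁) (hqW : q ∈ (G \ insert z B).erase x)
    (hq3 : q ∈ clF M (insert c₃ R₁)) (hqL : q ∉ clF M R₁) :
    dload M 5 G (bigP M G) (dshGT2 M 5 G) (insert z B ∪ {x, s, q}) = 0 := by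
  have hd' : (gr M \ G).card ≤ 5 := by omega
  have hGg : G ⊆ gr M := (mem_flatsQ.1 hG).1
  have hBm : B ∈ membersIn M (Uq M (5 + 2) 5) G := (mem_thinMembers.1 hB).1
  have hxQ : x ∉ insert z B := (Finset.mem_sdiff.1 hx).2
  have hQG : insert z B ⊆ G :=
    Finset.insert_subset (Finset.mem_sdiff.1 hz).1 (subset_G_of_mem_thinMembers hB)
  have hKQ : coloops M G ⊆ insert z B :=
    (coloops_subset_of_mem_thinMembers hG hd' hB).trans (Finset.subset_insert _ _)
  have hVg : (G \ coloops M G) \ {w₀, x} ⊆ gr M := fun e he =>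
    hGg (Finset.mem_sdiff.1 (Finset.mem_sdiff.1 he).1).1
  have hR₁g : R₁ ⊆ gr M := hR₁V.trans hVg
  have hc₂g : c₂ ∈ gr M := hVg hc₂V
  have hc₃g : c₃ ∈ gr M := hVg hc₃V
  have hsx : s ≠ x := (Finset.mem_erase.1 hsW).1
  have hqx : q ≠ x := (Finset.mem_erase.1 hqW).1
  have hsQ : s ∉ insert z B := (Finset.mem_sdiff.1 (Finset.mem_of_mem_erase hsW)).2
  have hqQ : q ∉ insert z B := (Finset.mem_sdiff.1 (Finset.mem_of_mem_erase hqW)).2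
  have hsq : s ≠ q := fun h' => hqL (h' ▸ hsL)
  have hWV : ∀ u ∈ (G \ insert z B).erase x, u ∈ (G \ coloops M G) \ {w₀, x} := by
    intro u hu
    rw [Finset.mem_erase, Finset.mem_sdiff] at hu
    rw [Finset.mem_sdiff, Finset.mem_sdiff, Finset.mem_insert, Finset.mem_singleton]
    refine ⟨⟨hu.2.1, fun h' => hu.2.2 (hKQ h')⟩, ?_⟩
    rintro (rfl | rfl)
    · exact hu.2.2 hw₀
    · exact hu.1 rfl
  have hP₀V : ∀ u ∈ (insert z B \ coloops M G).erase w₀, u ∈ (G \ coloops M G) \ {w₀, x} := by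
    intro u hu
    rw [Finset.mem_erase, Finset.mem_sdiff] at hu
    rw [Finset.mem_sdiff, Finset.mem_sdiff, Finset.mem_insert, Finset.mem_singleton]
    refine ⟨⟨hQG hu.2.1, hu.2.2⟩, ?_⟩
    rintro (rfl | rfl)
    · exact hu.1 rfl
    · exact hxQ hu.2.1
  have hXsub : ({x, s, q} : Finset α) ⊆ G \ insert z B := by
    intro e he
    rw [Finset.mem_insert, Finset.mem_insert, Finset.mem_singleton] at he
    rcases he with rfl | rfl | rfl
    · exact hx
    · exact Finset.mem_of_mem_erase hsW
    · exact Finset.mem_of_mem_erase hqW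
  have hTt : insert z B ∪ {x, s, q} ∈ tgtSets M 5 G B z := by
    rw [tgtSets_eq_image hG hBm hz, Finset.mem_image]
    exact ⟨{x, s, q}, Finset.mem_filter.2 ⟨Finset.mem_powerset.2 hXsub, ⟨x, Finset.mem_insert_self _ _⟩⟩, rfl⟩
  have hsd : (insert z B ∪ {x, s, q}) \ insert z B = {x, s, q} := by
    rw [Finset.union_sdiff_left]
    apply Finset.sdiff_eq_self_of_disjoint
    rw [Finset.disjoint_left]
    intro e he
    exact (Finset.mem_sdiff.1 (hXsub he)).2
  have hY : ((insert z B ∪ {x, s, q}) \ insert z B).erase x = {s, q} := by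
    rw [hsd, Finset.erase_insert]
    rw [Finset.mem_insert, Finset.mem_singleton, not_or]
    exact ⟨hsx.symm, hqx.symm⟩
  have hxT : x ∈ insert z B ∪ {x, s, q} := Finset.mem_union_right _ (Finset.mem_insert_self _ _)
  have hTG : insert z B ∪ {x, s, q} ⊆ G := subset_G_of_mem_shadowAt (mem_tgtSets.1 hTt).1
  have haG : a ∈ G := hQG (Finset.mem_sdiff.1 (Finset.mem_of_mem_erase haP)).1
  have hdG : d ∈ G := hQG (Finset.mem_sdiff.1 (Finset.mem_of_mem_erase hdP)).1
  have hsG : s ∈ G := (Finset.mem_sdiff.1 (Finset.mem_of_mem_erase hsW)).1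
  have hsa : s ≠ a := fun h' => hsQ (h' ▸ (Finset.mem_sdiff.1 (Finset.mem_of_mem_erase haP)).1)
  by_contra hload
  obtain ⟨R, hR, hR2, hR3, hcase⟩ := loaded_fat_target_dichotomy' hG hd hk hs hl hfat hB₀ hD hTG hload
  rcases hcase with ⟨hRc, -⟩ | ⟨hRc, -, c₂', hc₂'T, c₃', hc₃'T, hc₂', hc₃', hcover'⟩
  · -- distance one: the line of `s, q` and two basis points `a', b'`
    obtain ⟨a', ha', b', hb', hab', hrk⟩ :=
      exists_basis_line_of_dist_one_fat hG hd hk hs hB hnP hz hTt hxT hxQ hR hR2 hRc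
    rw [hY] at hrk
    have hR'V : insert a' (insert b' {s, q}) ⊆ (G \ coloops M G) \ {w₀, x} := by
      intro e he
      rw [Finset.mem_insert, Finset.mem_insert, Finset.mem_insert, Finset.mem_singleton] at he
      rcases he with rfl | rfl | rfl | rfl
      · exact hP₀V _ ha'
      · exact hP₀V _ hb'
      · exact hWV _ hsW
      · exact hWV _ hqW
    have hR'g : insert a' (insert b' {s, q}) ⊆ gr M := hR'V.trans hVg
    have hqR' : q ∈ insert a' (insert b' {s, q}) :=
      Finset.mem_insert_of_mem (Finset.mem_insert_of_mem (Finset.mem_insert_of_mem (Finset.mem_singleton_self _)))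
    have hsR' : s ∈ insert a' (insert b' {s, q}) :=
      Finset.mem_insert_of_mem (Finset.mem_insert_of_mem (Finset.mem_insert_self _ _))
    have ha'R : a' ∉ ({s, q} : Finset α) := by
      rw [Finset.mem_insert, Finset.mem_singleton, not_or]
      exact ⟨fun h' => hsQ (h' ▸ (Finset.mem_sdiff.1 (Finset.mem_of_mem_erase ha')).1),
        fun h' => hqQ (h' ▸ (Finset.mem_sdiff.1 (Finset.mem_of_mem_erase ha')).1)⟩
    have h3 : 3 ≤ (insert a' (insert b' {s, q}) : Finset α).card := by
      have h2 := Finset.card_le_card (show insert a' ({s, q} : Finset α) ⊆ insert a' (insert b' {s, q}) from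
        Finset.insert_subset_insert _ (Finset.subset_insert _ _))
      rw [Finset.card_insert_of_notMem ha'R, Finset.card_pair hsq] at h2
      exact h2
    have hR'π : insert a' (insert b' {s, q}) ⊆ clF M (insert c₃ R₁) := by
      rcases subset_plane_of_rkN_le_two_of_cover hs hR'g (by omega) h3 (fun e he => hcover e (hR'V he)) with h | h
      · exact absurd (mem_clF_of_mem_two_planes hR₁g hc₂g hc₃g hc₂ hc₃ (h hqR') hq3) hqL
      · exact h
    have hbasis : ∀ u ∈ (insert z B \ coloops M G).erase w₀, u ∈ (insert a' (insert b' {s, q}) : Finset α) →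
        u = a ∨ u = d := by
      intro u hu huR
      by_cases huL : u ∈ clF M R₁
      · exact Or.inl (hP₀a u (Finset.mem_of_mem_erase hu) huL)
      · exact Or.inr (hP₀d u (Finset.mem_of_mem_erase hu) (hR'π huR) huL)
    have ha'' := hbasis a' ha' (Finset.mem_insert_self _ _)
    have hb'' := hbasis b' hb' (Finset.mem_insert_of_mem (Finset.mem_insert_self _ _))
    -- `{a, s, d}` lies on the line
    have hsub : ({a, s, d} : Finset α) ⊆ (insert a' (insert b' {s, q}) : Finset α) := by
      intro e he
      rw [Finset.mem_insert, Finset.mem_insert, Finset.mem_singleton] at he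
      rcases he with rfl | rfl | rfl
      · rcases ha'' with h | h
        · rw [← h]; exact Finset.mem_insert_self _ _
        · rcases hb'' with h' | h'
          · rw [← h']; exact Finset.mem_insert_of_mem (Finset.mem_insert_self _ _)
          · exact absurd (h.trans h'.symm) hab'
      · exact hsR'
      · rcases ha'' with h | h
        · rcases hb'' with h' | h'
          · exact absurd (h.trans h'.symm) hab'
          · rw [← h']; exact Finset.mem_insert_of_mem (Finset.mem_insert_self _ _)
        · rw [← h]; exact Finset.mem_insert_self _ _
    have hrk3 : rkN M {a, s, d} ≤ 2 := by
      have := rkN_mono (M := M) hsub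
      omega
    have hdcl : d ∈ clF M {a, s} := mem_clF_pair_of_rkN_le_two hG hs haG hsG hdG hsa hrk3
    have hasL : ({a, s} : Finset α) ⊆ clF M R₁ := by
      intro e he
      rw [Finset.mem_insert, Finset.mem_singleton] at he
      rcases he with rfl | rfl
      · exact haL
      · exact hsL
    exact hdL (clF_subset_clF_of_subset_clF hasL hdcl)
  · -- distance two: the line lies in the spine and has at most the points `a, s`
    have hRL := line_subset_spine_of_dist_two_of_nondeg hG hs hR₁V hR₁2 hR₁3 hc₂V hc₃V hc₂ hc₃ hcover hnd₂ hnd₃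
      hTG hR hR2 hR3 hc₂'T hc₃'T hc₂' hc₃' hcover'
    have hsub : R ⊆ ({a, s} : Finset α) := by
      intro r hr
      have hr' := Finset.mem_sdiff.1 (hR hr)
      rw [Finset.mem_insert, Finset.mem_singleton, not_or] at hr'
      rw [Finset.mem_insert, Finset.mem_singleton]
      by_cases hrQ : r ∈ insert z B
      · exact Or.inl (hP₀a r (Finset.mem_sdiff.2 ⟨hrQ, (Finset.mem_sdiff.1 hr'.1).2⟩) (hRL hr))
      · have hrT : r ∈ ((insert z B ∪ {x, s, q}) \ insert z B).erase x :=
          Finset.mem_erase.2 ⟨hr'.2.2, Finset.mem_sdiff.2 ⟨(Finset.mem_sdiff.1 hr'.1).1, hrQ⟩⟩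
        rw [hY, Finset.mem_insert, Finset.mem_singleton] at hrT
        rcases hrT with rfl | rfl
        · exact Or.inr rfl
        · exact absurd (hRL hr) hqL
    have := Finset.card_le_card hsub
    have := Finset.card_le_two (a := a) (b := s)
    omega

end PercRepro.Shadow
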